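import Mathlib.Algebra.Lie.SkewAdjoint
import Mathlib.Algebra.Lie.Semisimple.Defs
import Mathlib.LinearAlgebra.BilinearForm.Properties
import Mathlib.RingTheory.Noetherian.Basic
import HarnessLib

/-!
# Deligne's *Weil I*, Lemma (5.11): the Lie-algebra lemma behind Kazhdan–Margulis (5.10)

Deligne, *La conjecture de Weil. I*, Publ. Math. IHÉS 43 (1974), §5, reduces the theorem of
Kazhdan–Margulis (5.10) ("L'image de `ρ : π₁(U, u) → Sp(E/(E ∩ E^⊥), ψ)` est ouverte", the
monodromy of a Lefschetz pencil is as large as possible) to a statement about Lie algebras: the Lie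
algebra `𝔏` of the (compact, hence `ℓ`-adic analytic) image of `ρ` is generated by the
Picard–Lefschetz transformations `N_s : x ↦ (x, δ_s) δ_s` of square zero, and `E/(E ∩ E^⊥)` is an
absolutely irreducible representation of `𝔏` (5.8); "Le théorème résulte du lemme suivant":

> **Lemme (5.11).** Soient `V` un espace vectoriel de dimension finie sur un corps `k` de
> caractéristique `0`, `ψ` une forme alternée non dégénérée et `𝔤` une sous-algèbre de Lie de
> `sp(V, ψ)`. On suppose que : (i) `V` est une représentation simple de `𝔤`. (ii) `𝔤` est engendrée
> par une famille d'endomorphismes de `V` de la forme `x ↦ ψ(x, δ)δ`. Alors, `𝔤 = sp(V, ψ)`.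

This file PROVES (5.11) on Mathlib's carriers (`LinearMap.BilinForm`, `LieSubalgebra k (Module.End k V)`,
`skewAdjointLieSubalgebra ψ = sp(V, ψ)`, `LieSubalgebra.lieSpan`, `LieModule.IsIrreducible`):
`WeilKazhdanMargulis.lieSubalgebra_eq_skewAdjoint_of_isIrreducible`. It is pure linear algebra and
uses nothing else from the paper; it is vendored here as one more object-free step of the proof of
(1.7) (cf. the sibling files `WeilConjecturesDeligneReductionProofs`, `WeilConjecturesDeligneKunnethProofs`).

## The proof (Deligne's, pp. 293–294, made finitary)

Write `N(δ) : x ↦ ψ(x, δ)δ` (local notation `𝐍[ψ, δ]` for Mathlib's `(ψ.flip δ).smulRight δ`),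
`M(δ, ε) = N(δ + ε) - N(δ) - N(ε)` (`𝐌[ψ, δ, ε]`) and `W = {δ | N(δ) ∈ 𝔤}`.
* a) `N(cδ) = c² N(δ)`, so `W` is a cone (`deligneN_smul`).
* b) `[N(δ), N(ε)] = ψ(ε, δ) M(δ, ε)` (`lie_deligneN`); hence for `δ, ε ∈ W` with `ψ(δ, ε) ≠ 0`,
  `M(δ, ε) ∈ 𝔤` and `δ + ε ∈ W` (`deligneN_add_mem`). (Deligne phrases this with the automorphism
  `exp(λ N(δ))` of `(V, ψ, 𝔤)`; the bracket identity is its derivative.)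
* c) If a linear subspace `A ⊆ W` is not `ψ`-orthogonal to `y ∈ W`, then `A + ky ⊆ W`
  (`deligneN_add_smul_mem`): for `a ∈ A` with `ψ(a, y) = 0` pick `a₀ ∈ A` with `ψ(a₀, y) ≠ 0`; then
  `(a + y) + t a₀ ∈ W` for all `t ≠ 0` by b), and since `N((a + y) + t a₀) = N(a + y) + t M + t² N(a₀)`
  is quadratic in `t`, three values `t = 1, -1, 2` give `N(a + y) ∈ 𝔤` (`mem_of_quadratic`; this
  replaces "`W` est réunion de ses sous-espaces linéaires maximaux, deux à deux orthogonaux").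
  Consequently a maximal linear subspace `A` of `W` containing a non-zero generator `δ₀` is stable
  under every generator `N(δ)` (either `δ ⊥ A` and `N(δ)A = 0`, or `δ ∈ A` by maximality), hence
  under `𝔤`, so `A = V` by (i) and `W = V`.
* Finally `sp(V, ψ)` is spanned by the `N(δ)`: for `g ∈ sp(V, ψ)` and a basis `(bᵢ)` with `ψ`-dual
  basis `(dᵢ)`, `2g = ∑ᵢ M(bᵢ, g dᵢ)` (`two_smul_eq_sum_deligneM`).
(If all generators vanish, `𝔤 = 0` and (i) forces `dim V = 1`, impossible for `ψ` alternating
nondegenerate; so a non-zero generator exists.)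

## Main results

* `WeilKazhdanMargulis.eq_skewAdjoint_of_generators` — (5.11) with (i)–(ii) in generator form
  (`N(δ) ∈ 𝔤` for `δ ∈ D`, and no proper non-zero subspace stable under these `N(δ)`).
* `WeilKazhdanMargulis.lieSubalgebra_eq_skewAdjoint_of_isIrreducible` — **(5.11) as printed**:
  `𝔤 ≤ sp(V, ψ)`, `LieModule.IsIrreducible k 𝔤 V`, `𝔤 = lieSpan {N(δ) | δ ∈ D}` ⟹ `𝔤 = sp(V, ψ)`.

## References

* P. Deligne, *La conjecture de Weil. I*, Publ. Math. IHÉS 43 (1974), 273–307: Théorème (5.10),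
  Lemme (5.11) and its proof, pp. 293–294. [Deligne1974]

## Design notes

* `gl(V)` is `Module.End k V` with the commutator bracket; as in `Mathlib.Algebra.Lie.SkewAdjoint`
  and `Mathlib.Algebra.Lie.Classical`, the (non-global) Mathlib instance `LieRing.ofAssociativeRing`
  is enabled with `attribute [local instance 100]` — no new instance is declared.
* `N(δ)` and `M(δ, ε)` are local notations for Mathlib terms, not definitions, so that the file is
  theorems only; statements about them read through `LinearMap.smulRight_apply`/`flip_apply`.
* What is NOT here: the theorem of Kazhdan–Margulis (5.10) itself (it needs the `ℓ`-adic monodromy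
  representation of a Lefschetz pencil, (5.8), and `ℓ`-adic Lie groups), and the orthogonal
  (`n` even) analogue, which Deligne does not use.
-/

open LinearMap (BilinForm)

namespace Literature.NumberTheory.LFunctions

namespace WeilKazhdanMargulis

variable {k : Type*} [Field k] {V : Type*} [AddCommGroup V] [Module k V]

-- As in `Mathlib.Algebra.Lie.SkewAdjoint` / `Mathlib.Algebra.Lie.Classical`: `gl(V) = End(V)` with the
-- commutator bracket (Mathlib keeps `LieRing.ofAssociativeRing` a non-global instance).
attribute [local instance 100] LieRing.ofAssociativeRing

/-- Deligne's `N(δ) : x ↦ ψ(x, δ) δ` ("transformations de carré nul"), written with Mathlib's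
`LinearMap.smulRight`/`LinearMap.flip` (local notation, no new definition). -/
local notation3 "𝐍[" ψ ", " δ "]" =>
  LinearMap.smulRight (LinearMap.flip (ψ : LinearMap.BilinForm _ _) δ) δ

/-- The polarisation `M(δ, ε) : x ↦ ψ(x, δ) ε + ψ(x, ε) δ` of `N`, so that
`N(δ + ε) = N(δ) + N(ε) + M(δ, ε)` (local notation). -/
local notation3 "𝐌[" ψ ", " δ ", " ε "]" =>
  LinearMap.smulRight (LinearMap.flip (ψ : LinearMap.BilinForm _ _) δ) ε +
    LinearMap.smulRight (LinearMap.flip (ψ : LinearMap.BilinForm _ _) ε) δ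

variable (ψ : BilinForm k V)

/-- `N(δ) x = ψ(x, δ) δ`. [cite: Deligne1974, proof of Lemme (5.11), p. 293] -/
theorem deligneN_apply (δ x : V) : (𝐍[ψ, δ] : Module.End k V) x = ψ x δ • δ := rfl

/-- `M(δ, ε) x = ψ(x, δ) ε + ψ(x, ε) δ`. [folklore] -/
theorem deligneM_apply (δ ε x : V) : (𝐌[ψ, δ, ε] : Module.End k V) x = ψ x δ • ε + ψ x ε • δ := rfl

/-- `N(c δ) = c² N(δ)`: the set `{δ | N(δ) ∈ 𝔤}` is a cone. [cite: Deligne1974, proof of Lemme (5.11) a), p. 293] -/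
theorem deligneN_smul (c : k) (δ : V) :
    (𝐍[ψ, c • δ] : Module.End k V) = (c * c) • 𝐍[ψ, δ] := by
  ext x
  simp only [LinearMap.smulRight_apply, LinearMap.flip_apply, LinearMap.smul_apply,
    BilinForm.smul_right, smul_smul]
  congr 1
  ring

/-- `N(u + t ε) = N(u) + t M(u, ε) + t² N(ε)` (quadratic dependence of `N` on `δ`). [folklore] -/
theorem deligneN_add_smul (u ε : V) (t : k) :
    (𝐍[ψ, u + t • ε] : Module.End k V) = 𝐍[ψ, u] + t • 𝐌[ψ, u, ε] + (t * t) • 𝐍[ψ, ε] := by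
  ext x
  simp only [LinearMap.smulRight_apply, LinearMap.flip_apply, LinearMap.add_apply,
    LinearMap.smul_apply, BilinForm.add_right, BilinForm.smul_right]
  module

/-- `N(δ + ε) = N(δ) + N(ε) + M(δ, ε)`. [folklore] -/
theorem deligneN_add (δ ε : V) :
    (𝐍[ψ, δ + ε] : Module.End k V) = 𝐍[ψ, δ] + 𝐍[ψ, ε] + 𝐌[ψ, δ, ε] := by
  have h := deligneN_add_smul ψ δ ε 1
  simp only [one_smul, one_mul] at h
  rw [h]; abel

variable {ψ}

/-- The bracket of two `N`'s: `[N(δ), N(ε)] = ψ(ε, δ) · M(δ, ε)` for `ψ` alternating.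
[cite: Deligne1974, proof of Lemme (5.11) b), p. 293] -/
theorem lie_deligneN (hψ : ψ.IsAlt) (δ ε : V) :
    ⁅(𝐍[ψ, δ] : Module.End k V), 𝐍[ψ, ε]⁆ = ψ ε δ • 𝐌[ψ, δ, ε] := by
  ext x
  rw [LieRing.of_associative_ring_bracket]
  simp only [LinearMap.sub_apply, Module.End.mul_apply, LinearMap.smulRight_apply,
    LinearMap.flip_apply, LinearMap.add_apply, LinearMap.smul_apply, BilinForm.smul_left]
  rw [← hψ.neg_eq δ ε]
  module

/-! ### Membership of `N(δ)` in a subspace of endomorphisms -/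

section Subspace

variable (S : Submodule k (Module.End k V))

/-- Quadratic interpolation at `t = 1, -1, 2` (characteristic `0`): if `A + tB + t²C ∈ S` for these
three values of `t`, then `A, B, C ∈ S`. [folklore] -/
theorem mem_of_quadratic [CharZero k] {A B C : Module.End k V} (h₁ : A + B + C ∈ S)
    (h₂ : A - B + C ∈ S) (h₃ : A + (2 : k) • B + (4 : k) • C ∈ S) : A ∈ S ∧ B ∈ S ∧ C ∈ S := by
  have hB : B ∈ S := by
    have h : (2⁻¹ : k) • ((A + B + C) - (A - B + C)) ∈ S := S.smul_mem _ (S.sub_mem h₁ h₂)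
    have e : (2⁻¹ : k) • ((A + B + C) - (A - B + C)) = B := by
      rw [show (A + B + C) - (A - B + C) = (2 : k) • B by module, smul_smul,
        inv_mul_cancel₀ (two_ne_zero' k), one_smul]
    rwa [e] at h
  have hAC : A + C ∈ S := by
    have h := S.sub_mem h₁ hB
    rwa [show A + B + C - B = A + C by abel] at h
  have hC : C ∈ S := by
    have h : (3⁻¹ : k) • ((A + (2 : k) • B + (4 : k) • C) - (2 : k) • B - (A + C)) ∈ S :=
      S.smul_mem _ (S.sub_mem (S.sub_mem h₃ (S.smul_mem _ hB)) hAC)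
    have e : (3⁻¹ : k) • ((A + (2 : k) • B + (4 : k) • C) - (2 : k) • B - (A + C)) = C := by
      rw [show (A + (2 : k) • B + (4 : k) • C) - (2 : k) • B - (A + C) = (3 : k) • C by module,
        smul_smul, inv_mul_cancel₀ (by norm_num : (3 : k) ≠ 0), one_smul]
    rwa [e] at h
  have hA : A ∈ S := by
    have h := S.sub_mem hAC hC
    rwa [add_sub_cancel_right] at h
  exact ⟨hA, hB, hC⟩

/-- `N(cδ) ∈ S` when `N(δ) ∈ S` (a) of the proof of (5.11): `W` is stable under homotheties).
[cite: Deligne1974, proof of Lemme (5.11) a), p. 293] -/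
theorem deligneN_smul_mem {δ : V} (h : 𝐍[ψ, δ] ∈ S) (c : k) : 𝐍[ψ, (c • δ)] ∈ S := by
  rw [deligneN_smul]; exact S.smul_mem _ h

variable {S}

/-- b) of the proof of (5.11), Lie-subalgebra form: if `S` is closed under brackets, `N(δ), N(ε) ∈ S`
and `ψ(δ, ε) ≠ 0`, then `N(δ + ε) ∈ S` (indeed `M(δ, ε) = ψ(ε, δ)⁻¹ [N(δ), N(ε)] ∈ S`).
[cite: Deligne1974, proof of Lemme (5.11) b), p. 293] -/
theorem deligneN_add_mem (hψ : ψ.IsAlt) (hS : ∀ f g, f ∈ S → g ∈ S → ⁅f, g⁆ ∈ S) {δ ε : V}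
    (hδ : 𝐍[ψ, δ] ∈ S) (hε : 𝐍[ψ, ε] ∈ S) (hne : ψ δ ε ≠ 0) :
    𝐍[ψ, (δ + ε)] ∈ S := by
  have hne' : ψ ε δ ≠ 0 := by rwa [← hψ.neg_eq δ ε, neg_ne_zero]
  have hM : 𝐌[ψ, δ, ε] ∈ S := by
    have h : (ψ ε δ)⁻¹ • ⁅(𝐍[ψ, δ] : Module.End k V), 𝐍[ψ, ε]⁆ ∈ S := S.smul_mem _ (hS _ _ hδ hε)
    rwa [lie_deligneN hψ, smul_smul, inv_mul_cancel₀ hne', one_smul] at h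
  rw [deligneN_add]
  exact S.add_mem (S.add_mem hδ hε) hM

/-- The key step c) of the proof of (5.11), in the form: if a subspace `A ⊆ W = {δ | N(δ) ∈ S}` is
not `ψ`-orthogonal to some `y ∈ W`, then `A + k y ⊆ W`. (For `a ∈ A` with `ψ(a, y) = 0` one uses
`N((a + y) + t a₀) ∈ S` for `t = 1, -1, 2`, where `ψ(a₀, y) ≠ 0`, and quadratic interpolation.)
[cite: Deligne1974, proof of Lemme (5.11) b)–c), pp. 293–294] -/
theorem deligneN_add_smul_mem [CharZero k] (hψ : ψ.IsAlt)
    (hS : ∀ f g, f ∈ S → g ∈ S → ⁅f, g⁆ ∈ S) {A : Submodule k V}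
    (hA : ∀ a ∈ A, 𝐍[ψ, a] ∈ S) {y : V} (hy : 𝐍[ψ, y] ∈ S) {a₀ : V} (ha₀ : a₀ ∈ A)
    (h₀ : ψ a₀ y ≠ 0) {a : V} (ha : a ∈ A) (c : k) : 𝐍[ψ, (a + c • y)] ∈ S := by
  rcases eq_or_ne c 0 with rfl | hc
  · simpa using hA a ha
  have hy' : 𝐍[ψ, (c • y)] ∈ S := deligneN_smul_mem S hy c
  have h₀' : ψ a₀ (c • y) ≠ 0 := by rw [BilinForm.smul_right]; exact mul_ne_zero hc h₀
  by_cases hay : ψ a (c • y) = 0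
  swap
  · exact deligneN_add_mem hψ hS (hA a ha) hy' hay
  -- `N((a + c y) + t a₀) ∈ S` for every `t ≠ 0`
  have key : ∀ t : k, t ≠ 0 →
      𝐍[ψ, (a + c • y)] + t • 𝐌[ψ, (a + c • y), a₀] + (t * t) • 𝐍[ψ, a₀] ∈ S := by
    intro t ht
    rw [← deligneN_add_smul]
    have e : a + c • y + t • a₀ = (a + t • a₀) + c • y := by abel
    rw [e]
    refine deligneN_add_mem hψ hS (hA _ (A.add_mem ha (A.smul_mem t ha₀))) hy' ?_
    rw [BilinForm.add_left, BilinForm.smul_left, hay, zero_add]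
    exact mul_ne_zero ht h₀'
  have h₁ := key 1 one_ne_zero
  have h₂ := key (-1) (neg_ne_zero.mpr one_ne_zero)
  have h₃ := key 2 two_ne_zero
  simp only [one_smul, one_mul, neg_smul, neg_mul, neg_neg] at h₁ h₂ h₃
  refine (mem_of_quadratic S h₁ (by simpa [sub_eq_add_neg] using h₂) ?_).1
  rwa [show ((2 : k) * 2) = 4 by norm_num] at h₃

end Subspace

/-! ### `sp(V, ψ)` is spanned by the `N(δ)` -/

section Span

variable {ι : Type*} [DecidableEq ι] [Fintype ι]

/-- Coordinates in a basis `b` via the `ψ`-dual basis `d`: `ψ(dᵢ, x) = (b.repr x)ᵢ`. [folklore] -/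
theorem apply_dualBasis_eq_repr (hψn : ψ.Nondegenerate) (b : Module.Basis ι k V) (x : V) (i : ι) :
    ψ (ψ.dualBasis hψn b i) x = b.repr x i := by
  conv_lhs => rw [← b.sum_repr x]
  simp_rw [map_sum, map_smul, smul_eq_mul, BilinForm.apply_dualBasis_left hψn b]
  simp

/-- Expansion in the basis `b` with `ψ`-dual coefficients: `x = ∑ᵢ ψ(dᵢ, x) bᵢ`. [folklore] -/
theorem sum_apply_dualBasis_smul (hψn : ψ.Nondegenerate) (b : Module.Basis ι k V) (x : V) :
    ∑ i, ψ (ψ.dualBasis hψn b i) x • b i = x := by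
  conv_rhs => rw [← b.sum_repr x]
  simp_rw [apply_dualBasis_eq_repr hψn b x]

/-- Expansion in the `ψ`-dual basis `d`: `x = ∑ᵢ ψ(x, bᵢ) dᵢ`. [folklore] -/
theorem sum_apply_smul_dualBasis (hψn : ψ.Nondegenerate) (b : Module.Basis ι k V) (x : V) :
    ∑ i, ψ x (b i) • ψ.dualBasis hψn b i = x := by
  conv_rhs => rw [← (ψ.dualBasis hψn b).sum_repr x]
  simp_rw [BilinForm.dualBasis_repr_apply]

/-- For `g ∈ sp(V, ψ)` (`ψ` alternating nondegenerate) and a basis `b` with `ψ`-dual basis `d`,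
`2g = ∑ᵢ M(bᵢ, g dᵢ)`: so `sp(V, ψ)` is spanned by the `N(δ)` ("l'algèbre de Lie `sp(V, ψ)` est
engendrée par les `N(δ)` (`δ ∈ V`)"). [cite: Deligne1974, proof of Lemme (5.11) c), p. 294] -/
theorem two_smul_eq_sum_deligneM (hψa : ψ.IsAlt) (hψn : ψ.Nondegenerate) (b : Module.Basis ι k V)
    {g : Module.End k V} (hg : ψ.IsSkewAdjoint g) :
    (2 : k) • g = ∑ i, 𝐌[ψ, (b i), (g (ψ.dualBasis hψn b i))] := by
  ext x
  simp only [LinearMap.smul_apply, LinearMap.coe_sum, Finset.sum_apply, deligneM_apply]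
  rw [Finset.sum_add_distrib, two_smul]
  congr 1
  · conv_lhs => rw [← sum_apply_smul_dualBasis hψn b x]
    simp [map_sum, map_smul]
  · conv_lhs => rw [← sum_apply_dualBasis_smul hψn b (g x)]
    refine Finset.sum_congr rfl fun i _ => ?_
    congr 1
    have h := hg (ψ.dualBasis hψn b i) x
    simp only [Pi.neg_apply, map_neg] at h
    rw [← hψa.neg_eq x, neg_inj] at h
    exact h.symm

/-- If a subspace `S ⊆ End(V)` contains every `N(δ)`, it contains `sp(V, ψ)`.
[cite: Deligne1974, proof of Lemme (5.11) c), p. 294] -/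
theorem mem_of_forall_deligneN_mem [CharZero k] [FiniteDimensional k V] (hψa : ψ.IsAlt)
    (hψn : ψ.Nondegenerate) (S : Submodule k (Module.End k V)) (hN : ∀ δ, 𝐍[ψ, δ] ∈ S)
    {g : Module.End k V} (hg : ψ.IsSkewAdjoint g) : g ∈ S := by
  have hM : ∀ δ ε, 𝐌[ψ, δ, ε] ∈ S := fun δ ε => by
    have h := S.sub_mem (S.sub_mem (hN (δ + ε)) (hN δ)) (hN ε)
    rwa [deligneN_add, show ∀ a b c : Module.End k V, a + b + c - a - b = c from
      fun a b c => by abel] at h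
  have h2 : (2 : k) • g ∈ S := by
    rw [two_smul_eq_sum_deligneM hψa hψn (Module.finBasis k V) hg]
    exact S.sum_mem fun i _ => hM _ _
  have h := S.smul_mem (2⁻¹ : k) h2
  rwa [smul_smul, inv_mul_cancel₀ two_ne_zero, one_smul] at h

end Span

/-! ### Lemma (5.11) -/

section Main

/-- **Deligne, Weil I, Lemme (5.11)** — generator form. Let `ψ` be a nondegenerate alternating
form on a nonzero finite-dimensional vector space `V` over a field of characteristic `0`, `𝔤` a
Lie subalgebra of `sp(V, ψ)` containing the `N(δ) : x ↦ ψ(x, δ)δ` for `δ` in a set `D`, and suppose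
that the only subspaces of `V` stable under all `N(δ)`, `δ ∈ D`, are `0` and `V`. Then
`𝔤 = sp(V, ψ)`. (Proof as printed: `W = {δ | N(δ) ∈ 𝔤}` is a cone (a)), a maximal linear
subspace `A ∋ δ₀` of `W`, `δ₀ ∈ D ∖ 0`, is stable under the `N(δ)`, `δ ∈ D` (b), c)), hence
`A = V`, `W = V`, and `sp(V, ψ)` is spanned by the `N(δ)`.)
[cite: Deligne1974, Lemme (5.11), pp. 293–294] -/
theorem eq_skewAdjoint_of_generators [CharZero k] [FiniteDimensional k V] [Nontrivial V]
    (hψa : ψ.IsAlt) (hψn : ψ.Nondegenerate) (𝔤 : LieSubalgebra k (Module.End k V))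
    (h𝔤 : 𝔤 ≤ skewAdjointLieSubalgebra ψ) (D : Set V) (hD : ∀ δ ∈ D, 𝐍[ψ, δ] ∈ 𝔤)
    (hirr : ∀ A : Submodule k V, (∀ δ ∈ D, ∀ x ∈ A, 𝐍[ψ, δ] x ∈ A) → A = ⊥ ∨ A = ⊤) :
    𝔤 = skewAdjointLieSubalgebra ψ := by
  -- a nonzero generator exists
  obtain ⟨δ₀, hδ₀D, hδ₀⟩ : ∃ δ₀ ∈ D, δ₀ ≠ 0 := by
    by_contra! hD0
    obtain ⟨v, hv⟩ := exists_ne (0 : V)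
    rcases hirr (k ∙ v) (fun δ hδ x _ => by simp [hD0 δ hδ]) with h | h
    · exact hv (Submodule.span_singleton_eq_bot.1 h)
    · refine hv (hψn.1 v fun w => ?_)
      obtain ⟨c, rfl⟩ := Submodule.mem_span_singleton.1 (h ▸ Submodule.mem_top : w ∈ k ∙ v)
      rw [BilinForm.smul_right, hψa.self_eq_zero, mul_zero]
  set S : Submodule k (Module.End k V) := 𝔤.toSubmodule
  have hS : ∀ f g, f ∈ S → g ∈ S → ⁅f, g⁆ ∈ S := fun f g hf hg => 𝔤.lie_mem hf hg
  -- a maximal subspace `A` with `δ₀ ∈ A ⊆ W`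
  set 𝒜 : Set (Submodule k V) := {A | δ₀ ∈ A ∧ ∀ a ∈ A, 𝐍[ψ, a] ∈ S}
  have h𝒜 : (k ∙ δ₀) ∈ 𝒜 := ⟨Submodule.mem_span_singleton_self δ₀, fun a ha => by
    obtain ⟨c, rfl⟩ := Submodule.mem_span_singleton.1 ha
    exact deligneN_smul_mem S (hD δ₀ hδ₀D) c⟩
  obtain ⟨A, ⟨hδ₀A, hA⟩, hmax⟩ := wellFounded_gt.has_min 𝒜 ⟨_, h𝒜⟩
  -- `A` is stable under every generator
  have hstab : ∀ δ ∈ D, ∀ x ∈ A, 𝐍[ψ, δ] x ∈ A := by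
    intro δ hδ x hx
    rw [deligneN_apply]
    by_cases horth : ∀ a ∈ A, ψ a δ = 0
    · rw [horth x hx, zero_smul]; exact A.zero_mem
    push Not at horth
    obtain ⟨a₀, ha₀, h₀⟩ := horth
    suffices hδA : δ ∈ A from A.smul_mem _ hδA
    have hB : A ⊔ (k ∙ δ) ∈ 𝒜 := by
      refine ⟨Submodule.mem_sup_left hδ₀A, fun v hv => ?_⟩
      obtain ⟨a, ha, w, hw, rfl⟩ := Submodule.mem_sup.1 hv
      obtain ⟨c, rfl⟩ := Submodule.mem_span_singleton.1 hw
      exact deligneN_add_smul_mem hψa hS hA (hD δ hδ) ha₀ h₀ ha c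
    have heq : A ⊔ (k ∙ δ) = A :=
      (eq_of_le_of_not_lt le_sup_left (hmax _ hB)).symm
    rw [← heq]
    exact Submodule.mem_sup_right (Submodule.mem_span_singleton_self δ)
  -- hence `A = V` and `W = V`
  have hAtop : A = ⊤ := (hirr A hstab).resolve_left fun h => hδ₀ (by simpa [h] using hδ₀A)
  have hW : ∀ δ, 𝐍[ψ, δ] ∈ S := fun δ => hA δ (hAtop ▸ Submodule.mem_top)
  -- and `sp(V, ψ) ⊆ 𝔤`
  refine le_antisymm h𝔤 fun g hg => ?_
  exact mem_of_forall_deligneN_mem hψa hψn S hW ((LinearMap.mem_skewAdjointSubmodule g).1 hg)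

/-- **Deligne, Weil I, Lemme (5.11)** (the Lie-algebra lemma from which the theorem of
Kazhdan–Margulis (5.10) follows). Let `V` be a finite-dimensional vector space over a field `k` of
characteristic `0`, `ψ` a nondegenerate alternating form and `𝔤` a Lie subalgebra of `sp(V, ψ)`
(`skewAdjointLieSubalgebra ψ`). Suppose that (i) `V` is a simple representation of `𝔤`
(`LieModule.IsIrreducible`) and (ii) `𝔤` is generated by a family of endomorphisms of `V` of the
form `x ↦ ψ(x, δ)δ`. Then `𝔤 = sp(V, ψ)`. [cite: Deligne1974, Lemme (5.11), pp. 293–294] -/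
theorem lieSubalgebra_eq_skewAdjoint_of_isIrreducible [CharZero k] [FiniteDimensional k V]
    (hψa : ψ.IsAlt) (hψn : ψ.Nondegenerate) (𝔤 : LieSubalgebra k (Module.End k V))
    (h𝔤 : 𝔤 ≤ skewAdjointLieSubalgebra ψ) [LieModule.IsIrreducible k 𝔤 V] (D : Set V)
    (hgen : 𝔤 = LieSubalgebra.lieSpan k (Module.End k V) ((fun δ : V => (𝐍[ψ, δ] : Module.End k V)) '' D)) :
    𝔤 = skewAdjointLieSubalgebra ψ := by
  haveI : Nontrivial V := (LieSubmodule.nontrivial_iff k 𝔤 V).1 inferInstance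
  have hD : ∀ δ ∈ D, 𝐍[ψ, δ] ∈ 𝔤 := fun δ hδ => by
    rw [hgen]; exact LieSubalgebra.subset_lieSpan ⟨δ, hδ, rfl⟩
  refine eq_skewAdjoint_of_generators hψa hψn 𝔤 h𝔤 D hD fun A hA => ?_
  -- the stabiliser of `A` in `gl(V)` is a Lie subalgebra containing the generators, hence `𝔤`
  let stab : LieSubalgebra k (Module.End k V) :=
    { carrier := {g | ∀ x ∈ A, g x ∈ A}
      add_mem' := fun hf hg x hx => A.add_mem (hf x hx) (hg x hx)
      zero_mem' := fun x _ => by simp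
      smul_mem' := fun c _ hf x hx => A.smul_mem c (hf x hx)
      lie_mem' := fun {f g} hf hg x hx => by
        rw [LieRing.of_associative_ring_bracket]
        exact A.sub_mem (hf _ (hg x hx)) (hg _ (hf x hx)) }
  have hle : 𝔤 ≤ stab := by
    rw [hgen, LieSubalgebra.lieSpan_le]
    rintro _ ⟨δ, hδ, rfl⟩
    exact hA δ hδ
  let N : LieSubmodule k 𝔤 V :=
    { A with
      lie_mem := fun {g x} hx => hle g.2 x hx }
  rcases IsSimpleOrder.eq_bot_or_eq_top N with h | h
  · exact Or.inl ((LieSubmodule.toSubmodule_eq_bot N).2 h)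
  · exact Or.inr ((LieSubmodule.toSubmodule_eq_top N).2 h)

end Main

end WeilKazhdanMargulis

end Literature.NumberTheory.LFunctions
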